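import Mathlib
import Literature.Analysis.FluidPDE.GaussianVortexPlanar
import Literature.Analysis.FluidPDE.GaussianVortexPlanarProofs
import Literature.Analysis.FluidPDE.BiotSavart2DSymmetry
import Summits.AnomalousDissipation.AnomalousDissipation.Theorems.MarginalStabilityChainStretchedVortexRowsStubCellSolvabilityTools
import Summits.AnomalousDissipation.AnomalousDissipation.Theorems.MarginalStabilityChainStretchedVortexRowsStubCellSolvabilityAngularPrimitive
import Summits.AnomalousDissipation.AnomalousDissipation.Theorems.MarginalStabilityChainStretchedVortexRowsStubCellSolvabilityCircleMeans
import Summits.AnomalousDissipation.AnomalousDissipation.Theorems.MarginalStabilityChainStretchedVortexRowsStubCellSolvabilityRadialWeights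
import Summits.AnomalousDissipation.AnomalousDissipation.Theorems.MarginalStabilityChainStretchedVortexRowsStubCoreRotationLocalSkew
import HarnessLib

/-!
# Reduction of the cell problem `Λ_G w = g` to the elliptic stream problem
# (stub `stub_cellSolvability`, crux stmt-AnomalousDissipation-3009)

`stub_cellSolvability` (line `braid-closed-large-circulation-gluing`,
`MarginalStabilityChain.StretchedVortexRows`) asks, for every smooth point-symmetric datum `g` with
vanishing circle means and `|g| + |∇g| ≤ C(1+|ξ|)^k G`, for a smooth point-symmetric `w` with
vanishing circle means, `|w| + |∇w| ≤ C'(1+|ξ|)^{k+4} G`, `w ∈ Y`, convergent Biot–Savart integrals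
and `Λ_G w = ⟪v^G, ∇w⟫ + ⟪K∗w, ∇G⟫ = g` — the generalised Gallay–Wayne / Maekawa cell problem. This
file proves it FROM EXACTLY ONE ANALYTIC INPUT, written inline as the hypothesis of the registered
sub-goal `stub_cellSolvability_of_streamSolvability` (stream-function cell solvability): for every
smooth even circle-mean-free `F` with `|F| + |∇F| ≤ C(1+|ξ|)^j G` there is a smooth even
circle-mean-free `Ψ`, bounded with bounded gradient, solving
`ΔΨ + VΨ = F`, `V = G/(2Ω) = 4πG/φ(|ξ|²/4) = (|ξ|²/4)/(e^{|ξ|²/4} − 1)`, and represented by the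
Biot–Savart law, `K∗(ΔΨ) = ∇^⊥Ψ`.

## The proof (Gallay–Wayne's method, all modes at once)

Write `v^G = Ω ξ^⊥`, `Ω = (8π)⁻¹φ(|ξ|²/4)`, `φ = burgersPhi`, and let `A = ∂_θ⁻¹` be the mean-free
angular primitive `(A g)(ξ) = ∫₀^{2π} ((σ−π)/(2π)) g(cos σ·ξ + sin σ·ξ^⊥) dσ`
(`…StubCellSolvabilityAngularPrimitive`: smooth, `∂_θ A g = g − mean = g`, even,
`|A g| + |∇A g| ≤ 2πC(1+|ξ|)^k G`; `…StubCellSolvabilityCircleMeans`: the means vanish). Put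
`F = Ω⁻¹ A g` (`…StubCellSolvabilityRadialWeights`: `|Ω⁻¹| + |∇Ω⁻¹| ≤ 12π(1+|ξ|)²`, so
`|F| + |∇F| ≤ 24π²C(1+|ξ|)^{k+2} G` — "`1/Ω` costs two powers"), take `Ψ` from the input and set
**`w = F − VΨ = ΔΨ`**. Then `w` is smooth, even, circle-mean-free (`Ω⁻¹`, `V` are radial),
`|w| + |∇w| ≤ (24π²C + 8πC')(1+|ξ|)^{k+4} G` because `|V| + |∇V| ≤ 8π(1+|ξ|)³G` (so `max(k+2, 3)`
powers would do), `w ∈ Y` and the Biot–Savart integrals converge by the Gaussian moments, and by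
`stub_cellSolvability_angularPotential` (`…Tools`) with the stream function `Ψ` of `w`:
`Λ_G w = ∂_θ(Ω w + (G/2)Ψ) = ∂_θ(Ω F + (G/2 − ΩV)Ψ) = ∂_θ(A g) = g`, since `ΩΩ⁻¹ = 1`, `ΩV = G/2`.

## What is still missing (the hypothesis), as three Lean-level infrastructure pieces

The hypothesis is TRUE — on the angular modes `|m| ≥ 2`, the only ones carried by even
circle-mean-free data, `−Δ − V` is coercive because `sup_r r²V(r) = 4 sup_s s²/(eˢ−1) < 4 ≤ m²`
(Gallay–Wayne 2007, proof of Prop. 3.1: `inf(4/r² − h) > 0`) — but none of the three standard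
steps of its proof is in Mathlib. Stated as signatures a future worker could take
(`E = EuclideanSpace ℝ (Fin 2)`, `pt r θ = toLp 2 ![r cos θ, r sin θ]`, `V` as above):

1. **Lax–Milgram on the sector** (Hardy `∫ Ψ²/|ξ|² ≤ ¼ ∫ |∇Ψ|²` for even circle-mean-free `Ψ`,
   and `sup r²V < 4`):
   `∀ F : E → ℝ, Continuous F → (∀ ξ, F (-ξ) = F ξ) → (∀ r > 0, ∫ θ in 0..2π, F (pt r θ) = 0) →
    Integrable (fun ξ => (1 + ‖ξ‖) ^ 2 * F ξ ^ 2) →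
    ∃ Ψ : E → ℝ, (∀ ξ, Ψ (-ξ) = Ψ ξ) ∧ (∀ r > 0, ∫ θ in 0..2π, Ψ (pt r θ) = 0) ∧
      MemW1pLoc Ψ ∧ Integrable (fun ξ => ‖weakGradient Ψ ξ‖ ^ 2) ∧
      Integrable (fun ξ => Ψ ξ ^ 2 / ‖ξ‖ ^ 2) ∧
      ∀ χ : E → ℝ, ContDiff ℝ ∞ χ → HasCompactSupport χ →
        ∫ ξ, (⟪weakGradient Ψ ξ, gradient χ ξ⟫ - V ξ * Ψ ξ * χ ξ) = -∫ ξ, F ξ * χ ξ`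
   (weak solution of `ΔΨ + VΨ = F` in `Ḣ¹`; tested against ALL test functions, the odd and the
   radial parts of `χ` pairing to zero).
2. **Elliptic regularity, weak ⇒ smooth, on `ℝ²`**:
   `∀ Ψ f : E → ℝ, MemW1pLoc Ψ → ContDiff ℝ ∞ f →
    (∀ χ, ContDiff ℝ ∞ χ → HasCompactSupport χ → ∫ ξ, ⟪weakGradient Ψ ξ, gradient χ ξ⟫ = -∫ ξ, f ξ * χ ξ) →
    ∃ Ψ' : E → ℝ, ContDiff ℝ ∞ Ψ' ∧ (∀ᵐ ξ, Ψ' ξ = Ψ ξ) ∧ ∀ ξ, Δ Ψ' ξ = f ξ`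
   (applied with the smooth right-hand side `f = F − VΨ` after a first bootstrap, or iterated).
3. **Newtonian-potential / Biot–Savart representation and bounds for the class**:
   `∀ Ψ : E → ℝ, ContDiff ℝ ∞ Ψ → (∀ ξ, Ψ (-ξ) = Ψ ξ) → (∀ r > 0, ∫ θ in 0..2π, Ψ (pt r θ) = 0) →
    Integrable (fun ξ => ‖gradient Ψ ξ‖ ^ 2) →
    (∃ A N, ∀ ξ, |Δ Ψ ξ| ≤ A * (1 + ‖ξ‖) ^ N * gaussVortexProfile ξ) →
    (∃ C', ∀ ξ, |Ψ ξ| + ‖gradient Ψ ξ‖ ≤ C') ∧ ∀ ξ, biotSavart2D (Δ Ψ) ξ = perp (gradient Ψ ξ)`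
   (`Ψ − E∗ΔΨ`, `E = (2π)⁻¹ log|·|`, is harmonic of finite Dirichlet energy modulo affine maps,
   hence affine, hence `0` by evenness and the vanishing circle means; `K = ∇^⊥E`).

Chaining 1–3 gives the hypothesis of `stub_cellSolvability_of_streamSolvability` (with
`Δ Ψ + VΨ = F` pointwise from 2 and the bounds and representation from 3).

## References

* Th. Gallay, C. E. Wayne, *Existence and stability of asymmetric Burgers vortices*, J. Math.
  Fluid Mech. 9 (2007) 243–261 = arXiv:math/0503353, §3, Prop. 3.1 and its proof ((3.1)–(3.9));
  proof of Prop. 3.4 ("proceeding exactly as in the proof of Proposition 3.1 … the details are left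
  to the reader") for a second datum. [GallayWayne2006]
* Th. Gallay, Y. Maekawa, *Existence and stability of viscous vortices*, arXiv:1610.08384, §2.2
  Lemma 2.7, §4.1 (4.12). [GallayMaekawa2016]
-/

set_option linter.dupNamespace false

noncomputable section

open scoped BigOperators Topology RealInnerProductSpace ContDiff Laplacian
open Filter Set Function MeasureTheory WithLp

namespace Summit.AnomalousDissipation.AnomalousDissipation.Theorems.MarginalStabilityChainStretchedVortexRows

open Literature.Analysis.FluidPDE

/-! ### Two small calculus facts -/

/-- `|f − h| + |∇(f − h)| ≤ (|f| + |∇f|) + (|h| + |∇h|)` at points of differentiability. [folklore] -/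
theorem abs_sub_add_norm_gradient_sub_le {f h : EuclideanSpace ℝ (Fin 2) → ℝ}
    {ξ : EuclideanSpace ℝ (Fin 2)} (hf : DifferentiableAt ℝ f ξ) (hh : DifferentiableAt ℝ h ξ) :
    |f ξ - h ξ| + ‖gradient (fun η => f η - h η) ξ‖ ≤
      (|f ξ| + ‖gradient f ξ‖) + (|h ξ| + ‖gradient h ξ‖) := by
  have hgrad : gradient (fun η => f η - h η) ξ = gradient f ξ - gradient h ξ := by
    simp only [gradient, fderiv_fun_sub hf hh, map_sub]
  rw [hgrad]
  linarith [abs_sub (f ξ) (h ξ), norm_sub_le (gradient f ξ) (gradient h ξ)]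

/-- The gradient of a `C¹` function is continuous. [folklore] -/
theorem continuous_gradient_of_contDiff_one {f : EuclideanSpace ℝ (Fin 2) → ℝ} (hf : ContDiff ℝ 1 f) :
    Continuous (gradient f) :=
  (InnerProductSpace.toDual ℝ (EuclideanSpace ℝ (Fin 2))).symm.continuous.comp
    (hf.continuous_fderiv (by simp))

/-! ### The reduction -/

/-- **`stub_cellSolvability` from stream-function cell solvability** (registered on
stmt-AnomalousDissipation-3009 as the sub-goal `stub_cellSolvability_of_streamSolvability`).
HYPOTHESIS (the one missing analytic input, see the module docstring for its three-piece proof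
plan): for every smooth even circle-mean-free `F` with `|F| + |∇F| ≤ C(1+|ξ|)^j G` there is a smooth
even circle-mean-free `Ψ`, bounded with bounded gradient, with `ΔΨ + 4πG/φ(|ξ|²/4)·Ψ = F` and
`K∗(ΔΨ) = ∇^⊥Ψ`. CONCLUSION: the registered statement of `stub_cellSolvability`, verbatim, via
`w = Ω⁻¹∂_θ⁻¹g − VΨ`. [folklore] -/
theorem stub_cellSolvability_of_streamSolvability :
    (∀ (j : ℕ) (C : ℝ) (F : EuclideanSpace ℝ (Fin 2) → ℝ), ContDiff ℝ ∞ F → (∀ ξ, F (-ξ) = F ξ) →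
      (∀ r, 0 < r → ∫ θ in (0:ℝ)..(2 * Real.pi), F (toLp 2 ![r * Real.cos θ, r * Real.sin θ]) = 0) →
      (∀ ξ, |F ξ| + ‖gradient F ξ‖ ≤ C * (1 + ‖ξ‖) ^ j * gaussVortexProfile ξ) →
      ∃ (C' : ℝ) (Ψ : EuclideanSpace ℝ (Fin 2) → ℝ), ContDiff ℝ ∞ Ψ ∧ (∀ ξ, Ψ (-ξ) = Ψ ξ) ∧
        (∀ r, 0 < r → ∫ θ in (0:ℝ)..(2 * Real.pi), Ψ (toLp 2 ![r * Real.cos θ, r * Real.sin θ]) = 0) ∧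
        (∀ ξ, |Ψ ξ| + ‖gradient Ψ ξ‖ ≤ C') ∧
        (∀ ξ, Δ Ψ ξ + 4 * Real.pi * gaussVortexProfile ξ / burgersPhi (‖ξ‖ ^ 2 / 4) * Ψ ξ = F ξ) ∧
        ∀ ξ, biotSavart2D (Δ Ψ) ξ = perp (gradient Ψ ξ)) →
    ∀ (k : ℕ) (C : ℝ) (g : EuclideanSpace ℝ (Fin 2) → ℝ), ContDiff ℝ ∞ g → (∀ ξ, g (-ξ) = g ξ) →
      (∀ r, 0 < r → ∫ θ in (0:ℝ)..(2 * Real.pi), g (toLp 2 ![r * Real.cos θ, r * Real.sin θ]) = 0) →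
      (∀ ξ, |g ξ| + ‖gradient g ξ‖ ≤ C * (1 + ‖ξ‖) ^ k * gaussVortexProfile ξ) →
      ∃ (C' : ℝ) (w : EuclideanSpace ℝ (Fin 2) → ℝ), ContDiff ℝ ∞ w ∧ (∀ ξ, w (-ξ) = w ξ) ∧
        (∀ r, 0 < r → ∫ θ in (0:ℝ)..(2 * Real.pi), w (toLp 2 ![r * Real.cos θ, r * Real.sin θ]) = 0) ∧
        (∀ ξ, |w ξ| + ‖gradient w ξ‖ ≤ C' * (1 + ‖ξ‖) ^ (k + 4) * gaussVortexProfile ξ) ∧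
        MemGWSobolev w ∧
        (∀ ξ, Integrable (fun η => w η • biotSavartKernel2D (ξ - η))) ∧
        ∀ ξ, ⟪gaussVortexVelocity ξ, gradient w ξ⟫ + ⟪biotSavart2D w ξ, gradient gaussVortexProfile ξ⟫ = g ξ := by
  intro hS k C g hg heven hmean hbound
  /- Step 0: the ingredients -/
  obtain ⟨hA_smooth, hA_deriv, hA_even, hA_bound⟩ := stub_cellSolvability_angularPrimitive g hg
  obtain ⟨hrot_mean, hA_circ⟩ := stub_cellSolvability_circleMeans g hg.continuous hmean
  obtain ⟨hΩ_smooth, hV_smooth, hΩ_bound, hV_bound, hmom⟩ := stub_cellSolvability_radialWeights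
  set Ag : EuclideanSpace ℝ (Fin 2) → ℝ := fun ξ => ∫ σ in (0 : ℝ)..(2 * Real.pi),
    (σ - Real.pi) / (2 * Real.pi) * g (Real.cos σ • ξ + Real.sin σ • perp ξ) with hAg
  set Ωi : EuclideanSpace ℝ (Fin 2) → ℝ := fun ξ => 8 * Real.pi / burgersPhi (‖ξ‖ ^ 2 / 4) with hΩi
  set V : EuclideanSpace ℝ (Fin 2) → ℝ := fun ξ =>
    4 * Real.pi * gaussVortexProfile ξ / burgersPhi (‖ξ‖ ^ 2 / 4) with hV
  have hC : 0 ≤ C := by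
    have h := hbound 0
    have hG := gaussVortexProfile_pos (0 : EuclideanSpace ℝ (Fin 2))
    simp only [norm_zero, add_zero, one_pow, mul_one] at h
    nlinarith [abs_nonneg (g 0), norm_nonneg (gradient g 0)]
  have hdA : ∀ ξ, DifferentiableAt ℝ Ag ξ := fun ξ => (hA_smooth.differentiable (by simp)) ξ
  have hdΩ : ∀ ξ, DifferentiableAt ℝ Ωi ξ := fun ξ => (hΩ_smooth.differentiable (by simp)) ξ
  have hdV : ∀ ξ, DifferentiableAt ℝ V ξ := fun ξ => (hV_smooth.differentiable (by simp)) ξ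
  /- Step 1: the datum `F = Ω⁻¹ A g` of the stream problem -/
  set F : EuclideanSpace ℝ (Fin 2) → ℝ := fun ξ => Ωi ξ * Ag ξ with hF
  have hF_smooth : ContDiff ℝ ∞ F := hΩ_smooth.mul hA_smooth
  have hdF : ∀ ξ, DifferentiableAt ℝ F ξ := fun ξ => (hF_smooth.differentiable (by simp)) ξ
  have hF_even : ∀ ξ, F (-ξ) = F ξ := fun ξ => by
    have h1 : Ag (-ξ) = Ag ξ := hA_even heven ξ
    have h2 : Ωi (-ξ) = Ωi ξ := by simp [hΩi, norm_neg]
    simp only [hF, h1, h2]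
  have hF_mean : ∀ r, 0 < r →
      ∫ θ in (0 : ℝ)..(2 * Real.pi), F (toLp 2 ![r * Real.cos θ, r * Real.sin θ]) = 0 := by
    intro r _
    have hc : ∀ θ : ℝ, F (toLp 2 ![r * Real.cos θ, r * Real.sin θ]) =
        8 * Real.pi / burgersPhi (r ^ 2 / 4) * Ag (toLp 2 ![r * Real.cos θ, r * Real.sin θ]) := by
      intro θ
      simp only [hF, hΩi, norm_toLp_cos_sin, sq_abs]
    have h0 : ∫ θ in (0 : ℝ)..(2 * Real.pi), Ag (toLp 2 ![r * Real.cos θ, r * Real.sin θ]) = 0 :=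
      hA_circ r
    rw [intervalIntegral.integral_congr (g := fun θ : ℝ => 8 * Real.pi / burgersPhi (r ^ 2 / 4) *
      Ag (toLp 2 ![r * Real.cos θ, r * Real.sin θ])) (fun θ _ => hc θ),
      intervalIntegral.integral_const_mul, h0, mul_zero]
  have hF_bound : ∀ ξ, |F ξ| + ‖gradient F ξ‖ ≤
      24 * Real.pi ^ 2 * C * (1 + ‖ξ‖) ^ (k + 2) * gaussVortexProfile ξ := by
    intro ξ
    have h1 := abs_mul_add_norm_gradient_mul_le (hdΩ ξ) (hdA ξ)
    have h2 := hΩ_bound ξ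
    have h3 := hA_bound k C hbound ξ
    have hG := (gaussVortexProfile_pos ξ).le
    have h30 : 0 ≤ |Ag ξ| + ‖gradient Ag ξ‖ := by positivity
    calc |F ξ| + ‖gradient F ξ‖ ≤ (|Ωi ξ| + ‖gradient Ωi ξ‖) * (|Ag ξ| + ‖gradient Ag ξ‖) := h1
      _ ≤ (12 * Real.pi * (1 + ‖ξ‖) ^ 2) * (2 * Real.pi * C * (1 + ‖ξ‖) ^ k * gaussVortexProfile ξ) :=
          mul_le_mul h2 h3 h30 (by positivity)
      _ = 24 * Real.pi ^ 2 * C * (1 + ‖ξ‖) ^ (k + 2) * gaussVortexProfile ξ := by ring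
  /- Step 2: the stream function `Ψ` from the hypothesis, and `w = F − VΨ = ΔΨ` -/
  obtain ⟨C', Ψ, hΨs, hΨe, hΨm, hΨb, hΨeq, hΨbs⟩ :=
    hS (k + 2) (24 * Real.pi ^ 2 * C) F hF_smooth hF_even hF_mean hF_bound
  have hC' : 0 ≤ C' := le_trans (by positivity) (hΨb 0)
  have hdΨ : ∀ ξ, DifferentiableAt ℝ Ψ ξ := fun ξ => (hΨs.differentiable (by simp)) ξ
  set w : EuclideanSpace ℝ (Fin 2) → ℝ := fun ξ => F ξ - V ξ * Ψ ξ with hw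
  have hwΔ : ∀ ξ, w ξ = Δ Ψ ξ := fun ξ => by
    have h := hΨeq ξ
    simp only [hw, hV]
    linarith
  have hwfun : w = Δ Ψ := funext hwΔ
  have hw_smooth : ContDiff ℝ ∞ w := hF_smooth.sub (hV_smooth.mul hΨs)
  have hdw : ∀ ξ, DifferentiableAt ℝ w ξ := fun ξ => (hw_smooth.differentiable (by simp)) ξ
  have hw_cont : Continuous w := hw_smooth.continuous
  /- Step 3: the Gaussian size of `w` -/
  set Cw : ℝ := 24 * Real.pi ^ 2 * C + 8 * Real.pi * C' with hCw
  have hCw0 : 0 ≤ Cw := by positivity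
  have hw_bound : ∀ ξ, |w ξ| + ‖gradient w ξ‖ ≤ Cw * (1 + ‖ξ‖) ^ (k + 4) * gaussVortexProfile ξ := by
    intro ξ
    have hG := (gaussVortexProfile_pos ξ).le
    have hr : (1 : ℝ) ≤ 1 + ‖ξ‖ := by linarith [norm_nonneg ξ]
    have hdVΨ : DifferentiableAt ℝ (fun η => V η * Ψ η) ξ := (hdV ξ).mul (hdΨ ξ)
    have h1 := abs_sub_add_norm_gradient_sub_le (hdF ξ) hdVΨ
    have h2 := abs_mul_add_norm_gradient_mul_le (hdV ξ) (hdΨ ξ)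
    have h3 := hF_bound ξ
    have h4 := hV_bound ξ
    have h5 := hΨb ξ
    have hp1 : (1 + ‖ξ‖) ^ (k + 2) ≤ (1 + ‖ξ‖) ^ (k + 4) := pow_le_pow_right₀ hr (by omega)
    have hp2 : (1 + ‖ξ‖) ^ 3 ≤ (1 + ‖ξ‖) ^ (k + 4) := pow_le_pow_right₀ hr (by omega)
    have h40 : 0 ≤ |V ξ| + ‖gradient V ξ‖ := by positivity
    have hVΨ : |V ξ * Ψ ξ| + ‖gradient (fun η => V η * Ψ η) ξ‖ ≤
        8 * Real.pi * (1 + ‖ξ‖) ^ 3 * gaussVortexProfile ξ * C' :=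
      h2.trans (mul_le_mul h4 h5 (by positivity) (by positivity))
    calc |w ξ| + ‖gradient w ξ‖
        ≤ (|F ξ| + ‖gradient F ξ‖) + (|V ξ * Ψ ξ| + ‖gradient (fun η => V η * Ψ η) ξ‖) := h1
      _ ≤ 24 * Real.pi ^ 2 * C * (1 + ‖ξ‖) ^ (k + 2) * gaussVortexProfile ξ +
            8 * Real.pi * (1 + ‖ξ‖) ^ 3 * gaussVortexProfile ξ * C' := add_le_add h3 hVΨ
      _ ≤ 24 * Real.pi ^ 2 * C * (1 + ‖ξ‖) ^ (k + 4) * gaussVortexProfile ξ +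
            8 * Real.pi * (1 + ‖ξ‖) ^ (k + 4) * gaussVortexProfile ξ * C' := by
          gcongr
      _ = Cw * (1 + ‖ξ‖) ^ (k + 4) * gaussVortexProfile ξ := by rw [hCw]; ring
  obtain ⟨M, hM⟩ := (hmom (k + 4)).2
  have hw_abs : ∀ ξ, |w ξ| ≤ Cw * M := fun ξ =>
    calc |w ξ| ≤ |w ξ| + ‖gradient w ξ‖ := le_add_of_nonneg_right (norm_nonneg _)
      _ ≤ Cw * ((1 + ‖ξ‖) ^ (k + 4) * gaussVortexProfile ξ) := by rw [← mul_assoc]; exact hw_bound ξ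
      _ ≤ Cw * M := mul_le_mul_of_nonneg_left (hM ξ) hCw0
  have hw_int : Integrable w :=
    integrable_of_le_one_add_norm_pow_mul_gauss hw_cont (A := Cw) (N := k + 4) fun ξ => by
      rw [Real.norm_eq_abs, ← mul_assoc]
      exact le_trans (le_add_of_nonneg_right (norm_nonneg _)) (hw_bound ξ)
  /- Step 4: the seven clauses -/
  refine ⟨Cw, w, hw_smooth, fun ξ => ?_, fun r hr => ?_, hw_bound, ?_, fun ξ => ?_, fun ξ => ?_⟩
  · -- evenness
    have h2 : V (-ξ) = V ξ := by simp [hV, gaussVortexProfile, norm_neg]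
    simp only [hw, hF_even ξ, hΨe ξ, h2]
  · -- vanishing circle means
    have hcV : ∀ θ : ℝ, V (toLp 2 ![r * Real.cos θ, r * Real.sin θ]) = V (toLp 2 ![r * Real.cos 0, r * Real.sin 0]) := by
      intro θ; simp only [hV, gaussVortexProfile, norm_toLp_cos_sin]
    have hiF : IntervalIntegrable (fun θ : ℝ => F (toLp 2 ![r * Real.cos θ, r * Real.sin θ]))
        volume 0 (2 * Real.pi) :=
      (hF_smooth.continuous.comp (continuous_toLp_cos_sin r)).intervalIntegrable _ _
    have hiVΨ : IntervalIntegrable (fun θ : ℝ => V (toLp 2 ![r * Real.cos θ, r * Real.sin θ]) *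
        Ψ (toLp 2 ![r * Real.cos θ, r * Real.sin θ])) volume 0 (2 * Real.pi) :=
      ((hV_smooth.continuous.comp (continuous_toLp_cos_sin r)).mul
        (hΨs.continuous.comp (continuous_toLp_cos_sin r))).intervalIntegrable _ _
    simp only [hw]
    rw [intervalIntegral.integral_sub hiF hiVΨ, hF_mean r hr,
      intervalIntegral.integral_congr (g := fun θ : ℝ => V (toLp 2 ![r * Real.cos 0, r * Real.sin 0]) *
        Ψ (toLp 2 ![r * Real.cos θ, r * Real.sin θ])) (fun θ _ => by simp only [hcV θ]),
      intervalIntegral.integral_const_mul, hΨm r hr]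
    simp
  · -- membership in `Y`
    refine ⟨hw_smooth.of_le (by exact_mod_cast le_top), ?_⟩
    have hcont : Continuous fun x => (gaussVortexProfile x)⁻¹ * (w x ^ 2 + ‖gradient w x‖ ^ 2) :=
      ((contDiff_gaussVortexProfile (n := 0)).continuous.inv₀ fun x => (gaussVortexProfile_pos x).ne').mul
        ((hw_cont.pow 2).add ((continuous_gradient_of_contDiff_one (hw_smooth.of_le (by exact_mod_cast le_top))).norm.pow 2))
    refine integrable_of_le_one_add_norm_pow_mul_gauss hcont (A := Cw ^ 2) (N := 2 * (k + 4)) fun ξ => ?_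
    have hG := gaussVortexProfile_pos ξ
    have hb := hw_bound ξ
    have hsum : 0 ≤ |w ξ| + ‖gradient w ξ‖ := by positivity
    rw [Real.norm_eq_abs, abs_of_nonneg (by positivity), pow_mul', ← mul_assoc]
    have hsq : w ξ ^ 2 + ‖gradient w ξ‖ ^ 2 ≤ (Cw * (1 + ‖ξ‖) ^ (k + 4) * gaussVortexProfile ξ) ^ 2 := by
      calc w ξ ^ 2 + ‖gradient w ξ‖ ^ 2 ≤ (|w ξ| + ‖gradient w ξ‖) ^ 2 := by
            rw [← sq_abs (w ξ)]; nlinarith [abs_nonneg (w ξ), norm_nonneg (gradient w ξ)]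
        _ ≤ (Cw * (1 + ‖ξ‖) ^ (k + 4) * gaussVortexProfile ξ) ^ 2 := pow_le_pow_left₀ hsum hb 2
    calc (gaussVortexProfile ξ)⁻¹ * (w ξ ^ 2 + ‖gradient w ξ‖ ^ 2)
        ≤ (gaussVortexProfile ξ)⁻¹ * (Cw * (1 + ‖ξ‖) ^ (k + 4) * gaussVortexProfile ξ) ^ 2 := by gcongr
      _ = Cw ^ 2 * ((1 + ‖ξ‖) ^ (k + 4)) ^ 2 * gaussVortexProfile ξ := by
          field_simp
  · -- convergence of the Biot–Savart integrals
    exact integrable_smul_biotSavartKernel2D hw_int hw_abs ξ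
  · -- the cell equation
    have hstream : biotSavart2D w ξ = perp (gradient Ψ ξ) := by rw [hwfun]; exact hΨbs ξ
    have h1 := stub_cellSolvability_angularPotential w Ψ ξ (hdw ξ) (hdΨ ξ) hstream
    have hP : (fun η : EuclideanSpace ℝ (Fin 2) => (8 * Real.pi)⁻¹ * burgersPhi (‖η‖ ^ 2 / 4) * w η +
        gaussVortexProfile η / 2 * Ψ η) = Ag := by
      funext η
      have hφ : burgersPhi (‖η‖ ^ 2 / 4) ≠ 0 := (burgersPhi_pos _).ne'
      have hπ : Real.pi ≠ 0 := Real.pi_ne_zero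
      simp only [hw, hF, hΩi, hV]
      field_simp
      ring
    have h0 : ∫ σ in (0 : ℝ)..(2 * Real.pi), g (Real.cos σ • ξ + Real.sin σ • perp ξ) = 0 :=
      hrot_mean ξ
    rw [h1, hP, real_inner_gradient_right, hA_deriv ξ, h0, mul_zero, sub_zero]

end Summit.AnomalousDissipation.AnomalousDissipation.Theorems.MarginalStabilityChainStretchedVortexRows

end
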